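import Literature.Geometry.Lorentzian.AFEndRestrict
import Literature.Geometry.Lorentzian.AsymptoticFlatnessProofs
import HarnessLib

/-!
# Dilated end structures: strong asymptotic flatness of dilated data
# (helper for stub `stub_dilationThread`, line `capture-exports-censorship-diagonal-surgery`,
# crux `CaptureSuffices`, stmt-FinalStateConjecture-9953, route `PhaseMixingCapture`)

For an asymptotically flat end `e : AFEnd X` (open set `U`, radius `R`, chart
`chart : U ≅ {R < ‖x‖}`) and `λ > 0`, the **dilated end structure** `e'` has the same open set,
radius `λ R` and chart `λ • chart` (so that its inverse chart is `Φ'(y) = Φ(λ⁻¹ y)` and its far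
regions are `e'.far ρ = e.far (λ⁻¹ ρ)`); it is built inside the proof of `exists_afEnd_dilate`
(no new definition). If `D' = (λ² h, λ k)` is the `λ`-dilate of the data `D = (h, k)` (a `Prop`
relation, no metric is rebuilt here), then the chart components transform as
`h'ᵢⱼ(y) = hᵢⱼ(λ⁻¹ y)`, `k'ᵢⱼ(y) = λ⁻¹ kᵢⱼ(λ⁻¹ y)` (`hCoeff_dilate`, `kCoeff_dilate`), so the
Dafermos–Rodnianski decay `h = (1 + 2M/r) δ + o₂(r⁻¹)`, `k = o₁(r⁻²)` of `D` on `e` becomes the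
same decay of `D'` on `e'` with mass parameter `λ M` (`isStronglyAsymptoticallyFlatDR_dilate`:
`iteratedFDeriv` of `f ∘ (λ⁻¹ • ·)` is the composition with the linear dilation,
`ContinuousLinearEquiv.iteratedFDerivWithin_comp_right`, and little-`o` along
`Bornology.cobounded ℝ³` is invariant under dilations); and `e'` is the sole end of `X` iff `e`
is (`far` regions correspond). Packaged: `exists_afEnd_of_isDilate`.

This is the elementary scaling covariance of the notion "strongly asymptotically flat with one
end" (Christodoulou, CQG 16 (1999), p. A24; Dafermos–Rodnianski 2013, App. B.2.3), used to show
that Christodoulou's admissible class is invariant under homotheties `(h, k) ↦ (λ² h, λ k)`.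
-/

-- the doubled `FinalStateConjecture.FinalStateConjecture` path component trips dupNamespace
set_option linter.dupNamespace false
-- instance search on the nested operator spaces `E3 [×m]→L[ℝ] E3 →L[ℝ] E3 →L[ℝ] ℝ` is deep
set_option maxSynthPendingDepth 3

noncomputable section

namespace Summit.FinalStateConjecture.FinalStateConjecture.Theorems.CaptureSuffices.CaptureExportsCensorshipDiagonalSurgery

open Set Filter Asymptotics Bornology
open scoped Manifold ContDiff Topology
open Literature.Geometry.Lorentzian

/-! ### Analysis on `ℝ³`: dilations and decay of derivatives at infinity -/

section Analysis

/-- Dilations `y ↦ a • y`, `a ≠ 0`, tend to infinity at infinity (along `Bornology.cobounded`).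
[folklore] -/
theorem tendsto_smul_cobounded {a : ℝ} (ha : a ≠ 0) :
    Tendsto (fun y : E3 ↦ a • y) (cobounded E3) (cobounded E3) := by
  rw [← tendsto_norm_atTop_iff_cobounded]
  simp_rw [norm_smul]
  exact tendsto_norm_cobounded_atTop.const_mul_atTop (norm_pos_iff.2 ha)

/-- **Power decay of the `m`-th derivative at infinity is invariant under dilation of the
argument**: if `‖Dᵐ f(x)‖ = o(‖x‖ᵖ)` as `‖x‖ → ∞` then `‖Dᵐ (f ∘ (a • ·))(y)‖ = o(‖y‖ᵖ)`
(`Dᵐ(f ∘ L) = (Dᵐ f ∘ L) ∘ (L, …, L)` for the linear dilation `L`, of norm `≤ ‖L‖ᵐ ‖Dᵐ f ∘ L‖`,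
and `‖a • y‖ᵖ = |a|ᵖ ‖y‖ᵖ`). [folklore] -/
theorem isLittleO_iteratedFDeriv_comp_smul {f : E3 → E3 →L[ℝ] E3 →L[ℝ] ℝ} {m : ℕ} {p a : ℝ}
    (ha : a ≠ 0)
    (h : (fun x ↦ ‖iteratedFDeriv ℝ m f x‖) =o[cobounded E3] fun x ↦ ‖x‖ ^ p) :
    (fun y ↦ ‖iteratedFDeriv ℝ m (fun z ↦ f (a • z)) y‖) =o[cobounded E3] fun y ↦ ‖y‖ ^ p := by
  set L : E3 ≃L[ℝ] E3 := ContinuousLinearEquiv.equivOfInverse (a • ContinuousLinearMap.id ℝ E3)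
    (a⁻¹ • ContinuousLinearMap.id ℝ E3)
    (fun x ↦ by
      show a⁻¹ • a • x = x
      rw [smul_smul, inv_mul_cancel₀ ha, one_smul])
    (fun x ↦ by
      show a • a⁻¹ • x = x
      rw [smul_smul, mul_inv_cancel₀ ha, one_smul]) with hL
  have hLapply : ∀ y : E3, L y = a • y := fun y ↦ rfl
  have hcomp : (fun z ↦ f (a • z)) = f ∘ L := rfl
  have hder : ∀ y, iteratedFDeriv ℝ m (f ∘ L) y =
      (iteratedFDeriv ℝ m f (L y)).compContinuousLinearMap fun _ ↦ (L : E3 →L[ℝ] E3) := by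
    intro y
    have := L.iteratedFDerivWithin_comp_right f uniqueDiffOn_univ (mem_univ (L y)) m
    rwa [preimage_univ, iteratedFDerivWithin_univ, iteratedFDerivWithin_univ] at this
  have hbound : ∀ y, ‖iteratedFDeriv ℝ m (f ∘ L) y‖ ≤
      ‖(L : E3 →L[ℝ] E3)‖ ^ m * ‖iteratedFDeriv ℝ m f (a • y)‖ := by
    intro y
    rw [hder, ← hLapply]
    calc ‖(iteratedFDeriv ℝ m f (L y)).compContinuousLinearMap fun _ ↦ (L : E3 →L[ℝ] E3)‖
        ≤ ‖iteratedFDeriv ℝ m f (L y)‖ * ∏ _i : Fin m, ‖(L : E3 →L[ℝ] E3)‖ :=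
          ContinuousMultilinearMap.norm_compContinuousLinearMap_le _ _
      _ = ‖(L : E3 →L[ℝ] E3)‖ ^ m * ‖iteratedFDeriv ℝ m f (L y)‖ := by
          rw [Finset.prod_const, Finset.card_univ, Fintype.card_fin, mul_comm]
  have h1 := h.comp_tendsto (tendsto_smul_cobounded ha)
  have h2 : (fun y : E3 ↦ ‖a • y‖ ^ p) =O[cobounded E3] fun y ↦ ‖y‖ ^ p := by
    refine IsBigO.of_bound (‖a‖ ^ p) (Eventually.of_forall fun y ↦ ?_)
    rw [norm_smul, Real.mul_rpow (norm_nonneg _) (norm_nonneg _),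
      Real.norm_of_nonneg (mul_nonneg (Real.rpow_nonneg (norm_nonneg _) _)
        (Real.rpow_nonneg (norm_nonneg _) _)),
      Real.norm_of_nonneg (Real.rpow_nonneg (norm_nonneg _) _)]
  refine IsBigO.trans_isLittleO ?_ (h1.trans_isBigO h2)
  refine IsBigO.of_bound (‖(L : E3 →L[ℝ] E3)‖ ^ m) (Eventually.of_forall fun y ↦ ?_)
  rw [norm_norm, Function.comp_def, norm_norm, hcomp]
  exact hbound y

end Analysis

/-! ### The dilated end structure -/

section Dilate

variable {X : Type} [TopologicalSpace X] [ChartedSpace E3 X]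

/-- **The dilated end structure.** For an end `e` and `λ > 0` there is an end structure `e'` of
`X` (same open set `U`, radius `λ R`, chart `λ • e.chart`, i.e. `e.chart` followed by the
dilation `x ↦ λ x` of `ℝ³`, a diffeomorphism `{R < ‖x‖} ≅ {λ R < ‖y‖}`; closed at infinity
because its closed far sets are those of `e`) whose inverse chart is `Φ'(y) = Φ(λ⁻¹ y)` beyond
radius `λ R` and whose far regions are `e'.far ρ = e.far (λ⁻¹ ρ)`. Bartnik 1986, §1 (structures
of infinity differing by a linear change of coordinates). [folklore] -/
theorem exists_afEnd_dilate (e : AFEnd X) {lam : ℝ} (hlam : 0 < lam) :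
    ∃ e' : AFEnd X, e'.R = lam * e.R ∧
      (∀ y : E3, lam * e.R < ‖y‖ → e'.dataChartExt y = e.dataChartExt (lam⁻¹ • y)) ∧
      ∀ ρ : ℝ, e'.far ρ = e.far (lam⁻¹ * ρ) := by
  have hnorm : ∀ z : E3, ‖lam • z‖ = lam * ‖z‖ := fun z ↦ by
    rw [norm_smul, Real.norm_of_nonneg hlam.le]
  have hnorm' : ∀ y : E3, ‖lam⁻¹ • y‖ = lam⁻¹ * ‖y‖ := fun y ↦ by
    rw [norm_smul, Real.norm_of_nonneg (inv_pos.2 hlam).le]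
  have hmem : ∀ z : exteriorRegion e.R, lam • (z : E3) ∈ exteriorRegion (lam * e.R) := fun z ↦ by
    rw [mem_exteriorRegion, hnorm]
    exact mul_lt_mul_of_pos_left z.2 hlam
  have hmem' : ∀ y : exteriorRegion (lam * e.R), lam⁻¹ • (y : E3) ∈ exteriorRegion e.R :=
    fun y ↦ by
      rw [mem_exteriorRegion, hnorm', lt_inv_mul_iff₀ hlam]
      exact y.2
  have hsm : ContMDiff (𝓡 3) (𝓡 3) ∞ (fun z : E3 ↦ lam • z) := (contDiff_const_smul lam).contMDiff
  have hsm' : ContMDiff (𝓡 3) (𝓡 3) ∞ (fun y : E3 ↦ lam⁻¹ • y) :=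
    (contDiff_const_smul lam⁻¹).contMDiff
  -- the dilation `{R < ‖x‖} ≅ {λ R < ‖y‖}`
  let dil : Diffeomorph (𝓡 3) (𝓡 3) (exteriorRegion e.R) (exteriorRegion (lam * e.R)) ∞ :=
    { toFun := fun z ↦ ⟨lam • (z : E3), hmem z⟩
      invFun := fun y ↦ ⟨lam⁻¹ • (y : E3), hmem' y⟩
      left_inv := fun z ↦ Subtype.ext (by
        show lam⁻¹ • lam • (z : E3) = z
        rw [smul_smul, inv_mul_cancel₀ hlam.ne', one_smul])
      right_inv := fun y ↦ Subtype.ext (by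
        show lam • lam⁻¹ • (y : E3) = y
        rw [smul_smul, mul_inv_cancel₀ hlam.ne', one_smul])
      contMDiff_toFun := by
        refine (ContMDiff.subtypeVal_comp_iff _ _).1 fun z ↦ ?_
        exact (contMDiffAt_subtype_iff (f := fun z : E3 ↦ lam • z)).2 (hsm z)
      contMDiff_invFun := by
        refine (ContMDiff.subtypeVal_comp_iff _ _).1 fun y ↦ ?_
        exact (contMDiffAt_subtype_iff (f := fun y : E3 ↦ lam⁻¹ • y)).2 (hsm' y) }
  have hpre : ∀ s : Set ℝ, (e.chart.trans dil) ⁻¹' {x | ‖(x : E3)‖ ∈ s} =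
      e.chart ⁻¹' {x | lam * ‖(x : E3)‖ ∈ s} := by
    intro s
    ext p
    simp only [mem_preimage, mem_setOf_eq, Diffeomorph.coe_trans, Function.comp_apply]
    show ‖lam • ((e.chart p : exteriorRegion e.R) : E3)‖ ∈ s ↔ _
    rw [hnorm]
  refine ⟨⟨e.U, lam * e.R, mul_pos hlam e.R_pos, e.chart.trans dil, fun R' hR' ↦ ?_⟩, rfl,
    fun y hy ↦ ?_, fun ρ ↦ ?_⟩
  · -- closed at infinity: the closed far sets are those of `e`
    have h1 : (e.chart.trans dil) ⁻¹' {x | R' ≤ ‖(x : E3)‖} =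
        e.chart ⁻¹' {x | lam⁻¹ * R' ≤ ‖(x : E3)‖} := by
      have := hpre (Ici R')
      simp only [mem_Ici] at this
      rw [this]
      ext p
      simp only [mem_preimage, mem_setOf_eq, inv_mul_le_iff₀ hlam]
    rw [h1]
    exact e.isClosed_far _ ((lt_inv_mul_iff₀ hlam).2 hR')
  · -- the inverse chart
    have hy' : e.R < ‖lam⁻¹ • y‖ := by
      rw [hnorm', lt_inv_mul_iff₀ hlam]
      exact hy
    rw [AFEnd.dataChartExt_of_lt _ (show lam * e.R < ‖y‖ from hy), e.dataChartExt_of_lt hy']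
    rfl
  · -- the far regions
    show ((↑) : e.U → X) '' ((e.chart.trans dil) ⁻¹' {x | ρ < ‖(x : E3)‖}) =
      ((↑) : e.U → X) '' (e.chart ⁻¹' {x | lam⁻¹ * ρ < ‖(x : E3)‖})
    have := hpre (Ioi ρ)
    simp only [mem_Ioi] at this
    rw [this]
    congr 1
    ext p
    simp only [mem_preimage, mem_setOf_eq, inv_mul_lt_iff₀ hlam]

/-- **A dilated end structure is the sole end iff the original one is** (here: the forward
direction), since `e'.far (λ R') = e.far R'`. [folklore] -/
theorem isSoleEnd_dilate {e e' : AFEnd X} {lam : ℝ} (hlam : 0 < lam) (hR : e'.R = lam * e.R)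
    (hfar : ∀ ρ : ℝ, e'.far ρ = e.far (lam⁻¹ * ρ)) (h : e.IsSoleEnd) : e'.IsSoleEnd := by
  obtain ⟨R', hR', hK⟩ := h
  refine ⟨lam * R', ?_, ?_⟩
  · rw [hR]
    exact mul_lt_mul_of_pos_left hR' hlam
  · rw [hfar, ← mul_assoc, inv_mul_cancel₀ hlam.ne', one_mul]
    exact hK

end Dilate

/-! ### Chart components of dilated data in the dilated end structure -/

section Coeff

variable {X : Type} [TopologicalSpace X] [ChartedSpace E3 X] [IsManifold (𝓡 3) ∞ X]

/-- Transport of `h_p(v, w)` along an equality of base points (all tangent spaces are `ℝ³`).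
[folklore] -/
theorem h_inner_congr_point (D : InitialDataSet (𝓡 3) X) {p q : X} (h : p = q) (v w : E3) :
    D.h.inner p v w = D.h.inner q v w := by
  subst h
  rfl

/-- Transport of `k_p(v, w)` along an equality of base points. [folklore] -/
theorem k_congr_point (D : InitialDataSet (𝓡 3) X) {p q : X} (h : p = q) (v w : E3) :
    D.k p v w = D.k q v w := by
  subst h
  rfl

omit [IsManifold (𝓡 3) ∞ X] in
/-- **The differential of the inverse chart of a dilated end structure**:
`dΦ'_y(u) = λ⁻¹ dΦ_{λ⁻¹ y}(u)` beyond radius `λ R` (chain rule, `Φ' = Φ ∘ (λ⁻¹ • ·)` near `y`).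
[folklore] -/
theorem mfderiv_dataChartExt_dilate {e e' : AFEnd X} {lam : ℝ} (hlam : 0 < lam)
    (hchart : ∀ y : E3, lam * e.R < ‖y‖ → e'.dataChartExt y = e.dataChartExt (lam⁻¹ • y))
    {y : E3} (hy : lam * e.R < ‖y‖) (u : E3) :
    mfderiv 𝓘(ℝ, E3) (𝓡 3) e'.dataChartExt y u =
      lam⁻¹ • mfderiv 𝓘(ℝ, E3) (𝓡 3) e.dataChartExt (lam⁻¹ • y) u := by
  have hLy : e.R < ‖lam⁻¹ • y‖ := by
    rw [norm_smul, Real.norm_of_nonneg (inv_pos.2 hlam).le, lt_inv_mul_iff₀ hlam]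
    exact hy
  have hev : e'.dataChartExt =ᶠ[𝓝 y] (e.dataChartExt ∘ fun z : E3 ↦ lam⁻¹ • z) := by
    filter_upwards [(isOpen_lt continuous_const continuous_norm).mem_nhds hy] with z hz
    exact hchart z hz
  set L : E3 →L[ℝ] E3 := lam⁻¹ • ContinuousLinearMap.id ℝ E3 with hL
  have hLd : HasMFDerivAt 𝓘(ℝ, E3) 𝓘(ℝ, E3) (fun z : E3 ↦ lam⁻¹ • z) y L := L.hasMFDerivAt
  have hΦ : MDifferentiableAt 𝓘(ℝ, E3) (𝓡 3) e.dataChartExt (lam⁻¹ • y) :=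
    (e.contMDiffAt_dataChartExt hLy).mdifferentiableAt (by simp)
  rw [hev.mfderiv_eq, mfderiv_comp y hΦ hLd.mdifferentiableAt, hLd.mfderiv]
  show (mfderiv 𝓘(ℝ, E3) (𝓡 3) e.dataChartExt (lam⁻¹ • y)) (L u) = _
  exact (mfderiv 𝓘(ℝ, E3) (𝓡 3) e.dataChartExt (lam⁻¹ • y)).map_smul lam⁻¹ u

/-- **The metric components of dilated data in the dilated end structure**: if `h' = λ² h`
then `h'ᵢⱼ(y) = hᵢⱼ(λ⁻¹ y)` for all `y` (beyond radius `λ R` by the chain rule,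
`λ² · λ⁻¹ · λ⁻¹ = 1`; inside, both sides are the junk value `δ`). [folklore] -/
theorem hCoeff_dilate {e e' : AFEnd X} {lam : ℝ} (hlam : 0 < lam) (hR : e'.R = lam * e.R)
    (hchart : ∀ y : E3, lam * e.R < ‖y‖ → e'.dataChartExt y = e.dataChartExt (lam⁻¹ • y))
    {D D' : InitialDataSet (𝓡 3) X}
    (hh : ∀ (x : X) (v w : TangentSpace (𝓡 3) x), D'.h.inner x v w = lam ^ 2 * D.h.inner x v w)
    (y : E3) :
    AFEnd.hCoeff e' D' y = AFEnd.hCoeff e D (lam⁻¹ • y) := by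
  have hnorm' : ‖lam⁻¹ • y‖ = lam⁻¹ * ‖y‖ := by
    rw [norm_smul, Real.norm_of_nonneg (inv_pos.2 hlam).le]
  by_cases hy : lam * e.R < ‖y‖
  · have hy' : e'.R < ‖y‖ := by rw [hR]; exact hy
    have hLy : e.R < ‖lam⁻¹ • y‖ := by rw [hnorm', lt_inv_mul_iff₀ hlam]; exact hy
    ext v w
    rw [e'.hCoeff_apply_eq_dataChartExt _ hy', e.hCoeff_apply_eq_dataChartExt D hLy,
      mfderiv_dataChartExt_dilate hlam hchart hy v, mfderiv_dataChartExt_dilate hlam hchart hy w,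
      hh, h_inner_congr_point D (hchart y hy), map_smul, map_smul, smul_apply, smul_eq_mul,
      smul_eq_mul]
    field_simp
  · have hy2 : ¬ e'.R < ‖y‖ := by rw [hR]; exact hy
    have hLy : ¬ e.R < ‖lam⁻¹ • y‖ := by rw [hnorm', lt_inv_mul_iff₀ hlam]; exact hy
    rw [AFEnd.hCoeff, AFEnd.hCoeff, dif_neg hy2, dif_neg hLy]

/-- **The components of `k` of dilated data in the dilated end structure**: if `k' = λ k` then
`k'ᵢⱼ(y) = λ⁻¹ kᵢⱼ(λ⁻¹ y)` for all `y` (junk value `0` inside). [folklore] -/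
theorem kCoeff_dilate {e e' : AFEnd X} {lam : ℝ} (hlam : 0 < lam) (hR : e'.R = lam * e.R)
    (hchart : ∀ y : E3, lam * e.R < ‖y‖ → e'.dataChartExt y = e.dataChartExt (lam⁻¹ • y))
    {D D' : InitialDataSet (𝓡 3) X}
    (hk : ∀ (x : X) (v w : TangentSpace (𝓡 3) x), D'.k x v w = lam * D.k x v w) (y : E3) :
    AFEnd.kCoeff e' D' y = lam⁻¹ • AFEnd.kCoeff e D (lam⁻¹ • y) := by
  have hnorm' : ‖lam⁻¹ • y‖ = lam⁻¹ * ‖y‖ := by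
    rw [norm_smul, Real.norm_of_nonneg (inv_pos.2 hlam).le]
  by_cases hy : lam * e.R < ‖y‖
  · have hy' : e'.R < ‖y‖ := by rw [hR]; exact hy
    have hLy : e.R < ‖lam⁻¹ • y‖ := by rw [hnorm', lt_inv_mul_iff₀ hlam]; exact hy
    ext v w
    rw [smul_apply, smul_apply, e'.kCoeff_apply_eq_dataChartExt _ hy',
      e.kCoeff_apply_eq_dataChartExt D hLy, mfderiv_dataChartExt_dilate hlam hchart hy v,
      mfderiv_dataChartExt_dilate hlam hchart hy w, hk, k_congr_point D (hchart y hy), map_smul,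
      map_smul, smul_apply, smul_eq_mul, smul_eq_mul]
    field_simp
  · have hy2 : ¬ e'.R < ‖y‖ := by rw [hR]; exact hy
    have hLy : ¬ e.R < ‖lam⁻¹ • y‖ := by rw [hnorm', lt_inv_mul_iff₀ hlam]; exact hy
    rw [AFEnd.kCoeff, AFEnd.kCoeff, dif_neg hy2, dif_neg hLy, smul_zero]

/-- **Dafermos–Rodnianski decay of dilated data in the dilated end structure**: if
`h = (1 + 2M/r) δ + o₂(r⁻¹)`, `k = o₁(r⁻²)` on `e` and `(h', k') = (λ² h, λ k)`, then
`h' = (1 + 2(λM)/r) δ + o₂(r⁻¹)`, `k' = o₁(r⁻²)` on the dilated end structure `e'`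
(`h'ᵢⱼ - (1 + 2λM/‖y‖) δ = (hᵢⱼ - (1 + 2M/r) δ) ∘ (λ⁻¹ • ·)`, `k'ᵢⱼ = λ⁻¹ kᵢⱼ ∘ (λ⁻¹ • ·)`, and
`isLittleO_iteratedFDeriv_comp_smul`). Dafermos–Rodnianski 2013, App. B.2.3 (the class is
scale covariant). [folklore] -/
theorem isStronglyAsymptoticallyFlatDR_dilate {e e' : AFEnd X} {lam : ℝ} (hlam : 0 < lam)
    (hR : e'.R = lam * e.R)
    (hchart : ∀ y : E3, lam * e.R < ‖y‖ → e'.dataChartExt y = e.dataChartExt (lam⁻¹ • y))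
    {D D' : InitialDataSet (𝓡 3) X}
    (hh : ∀ (x : X) (v w : TangentSpace (𝓡 3) x), D'.h.inner x v w = lam ^ 2 * D.h.inner x v w)
    (hk : ∀ (x : X) (v w : TangentSpace (𝓡 3) x), D'.k x v w = lam * D.k x v w)
    {M : ℝ} (h : e.IsStronglyAsymptoticallyFlatDR D M) :
    e'.IsStronglyAsymptoticallyFlatDR D' (lam * M) := by
  have hinv : lam⁻¹ ≠ 0 := inv_ne_zero hlam.ne'
  refine ⟨fun m hm ↦ ?_, fun m hm ↦ ?_⟩
  · -- the metric part
    have h1 := h.1 m hm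
    set F : E3 → E3 →L[ℝ] E3 →L[ℝ] ℝ := fun x ↦ AFEnd.hCoeff e D x -
      (1 + 2 * M / ‖x‖) • (innerSL ℝ : E3 →L[ℝ] E3 →L[ℝ] ℝ) with hF
    have hfun : (fun y ↦ AFEnd.hCoeff e' D' y -
        (1 + 2 * (lam * M) / ‖y‖) • (innerSL ℝ : E3 →L[ℝ] E3 →L[ℝ] ℝ)) =
        fun y ↦ F (lam⁻¹ • y) := by
      funext y
      have hq : 2 * M / ‖lam⁻¹ • y‖ = 2 * (lam * M) / ‖y‖ := by
        rw [norm_smul, Real.norm_of_nonneg (inv_pos.2 hlam).le, ← div_div, div_inv_eq_mul]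
        ring
      simp only [hF, hCoeff_dilate hlam hR hchart hh, hq]
    rw [hfun]
    exact isLittleO_iteratedFDeriv_comp_smul (f := F) (a := lam⁻¹) hinv h1
  · -- the second fundamental form part
    have h2' := h.2 m hm
    set g : E3 → E3 →L[ℝ] E3 →L[ℝ] ℝ := fun z ↦ AFEnd.kCoeff e D (lam⁻¹ • z) with hg
    have hfun : AFEnd.kCoeff e' D' = fun y ↦ lam⁻¹ • g y := funext (kCoeff_dilate hlam hR hchart hk)
    have h2 : (fun y ↦ ‖iteratedFDeriv ℝ m g y‖) =o[cobounded E3]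
        fun y ↦ ‖y‖ ^ (-(2 : ℝ) - m) :=
      isLittleO_iteratedFDeriv_comp_smul (f := AFEnd.kCoeff e D) (a := lam⁻¹) hinv h2'
    have hmem : {y : E3 | lam * e.R < ‖y‖} ∈ cobounded E3 := by
      filter_upwards [eventually_cobounded_le_norm (E := E3) (lam * e.R + 1)] with y hy
      exact lt_of_lt_of_le (lt_add_one _) hy
    have hev : (fun y ↦ ‖lam⁻¹‖ * ‖iteratedFDeriv ℝ m g y‖) =ᶠ[cobounded E3]
        fun y ↦ ‖iteratedFDeriv ℝ m (fun x ↦ lam⁻¹ • g x) y‖ := by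
      filter_upwards [hmem] with y hy
      have hLy : e.R < ‖lam⁻¹ • y‖ := by
        rw [norm_smul, Real.norm_of_nonneg (inv_pos.2 hlam).le, lt_inv_mul_iff₀ hlam]
        exact hy
      have hG : ContDiffAt ℝ (m : ℕ∞ω) g y := by
        have hk' : ContDiffAt ℝ ∞ (AFEnd.kCoeff e D) (lam⁻¹ • y) :=
          (AFEnd.ContDiffOn_kCoeff_holds e D).contDiffAt
            ((isOpen_lt continuous_const continuous_norm).mem_nhds hLy)
        exact (hk'.of_le (WithTop.coe_le_coe.mpr le_top)).comp y
          ((contDiff_const_smul (lam⁻¹ : ℝ)).contDiffAt.of_le (WithTop.coe_le_coe.mpr le_top))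
      rw [iteratedFDeriv_const_smul_apply' hG, norm_smul]
    rw [hfun]
    exact (h2.const_mul_left ‖lam⁻¹‖).congr' hev EventuallyEq.rfl

/-- **Strong asymptotic flatness with one end is dilation covariant.** If `D = (h, k)` is
Dafermos–Rodnianski asymptotically flat with mass parameter `M` on an end structure `e` which is
the sole end of `X`, and `D' = (λ² h, λ k)`, `λ > 0`, then `D'` is Dafermos–Rodnianski
asymptotically flat with mass parameter `λ M` on an end structure `e'` (the dilated one) which
is the sole end of `X`. Christodoulou, CQG 16 (1999), p. A24; Dafermos–Rodnianski 2013,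
App. B.2.3. [folklore] -/
theorem exists_afEnd_of_isDilate :
    ∀ (X : Type) [TopologicalSpace X] [ChartedSpace E3 X] [IsManifold (𝓡 3) ∞ X] (e : AFEnd X)
      (D D' : InitialDataSet (𝓡 3) X) (lam M : ℝ), 0 < lam →
      (∀ (x : X) (v w : TangentSpace (𝓡 3) x), D'.h.inner x v w = lam ^ 2 * D.h.inner x v w) →
      (∀ (x : X) (v w : TangentSpace (𝓡 3) x), D'.k x v w = lam * D.k x v w) →
      e.IsSoleEnd → e.IsStronglyAsymptoticallyFlatDR D M →
        ∃ e' : AFEnd X, e'.IsSoleEnd ∧ e'.IsStronglyAsymptoticallyFlatDR D' (lam * M) := by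
  intro X _ _ _ e D D' lam M hlam hh hk hsole hSAF
  obtain ⟨e', hR, hchart, hfar⟩ := exists_afEnd_dilate e hlam
  exact ⟨e', isSoleEnd_dilate hlam hR hfar hsole,
    isStronglyAsymptoticallyFlatDR_dilate hlam hR hchart hh hk hSAF⟩

end Coeff

end Summit.FinalStateConjecture.FinalStateConjecture.Theorems.CaptureSuffices.CaptureExportsCensorshipDiagonalSurgery

end
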